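import Summits.ABC.IUTFork.Repair.RHLinearReachLawMixedDoor
import Summits.ABC.IUTFork.Repair.RHLinearReachLawMixedVsSlotReach
import Summits.ABC.IUTFork.Repair.RHSlotReachSigma
import Summits.ABC.IUTFork.Repair.RHSigmaLicence
import Summits.ABC.IUTFork.Cor312ProvKIdeles
import Summits.ABC.IUTFork.Cor312VolumesRealAssembly
import HarnessLib

/-!
# D-0079 RESCUE sub-cell R-H, row 20′ «tuple reach cell» — `RHLinearReachLawMixedSigma`: Σ₂₀′ AS A WINDOW OF CELLS, the (xi-f) licence ON IT a THEOREM
# (any pilot datum with realising ideles; the genuine bed with the CHOSEN ideles), and the nesting Σ₁₅ ⊆ Σ₂₀′ cell by cell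

DEFS + proofs file (abc-iut cell, rung LADDER-ABC:A2.RESCUE.H; seat abc-iut-rh-typ-7 gen 6, row-20 lineage; twin of abc-iut-rh-typ-12's
`Repair/RHSlotReachSigma.lean` (Σ₁₅) and abc-iut-rh2-xi-2's `RHInSigmaDatum.sigmaLevelWindow` (Σ₁₈) for THIS family). TAKES NO SIDE on [IUTchIII] Cor. 3.12
or on any author; nothing here asserts abc proved or refuted; `CellReachMixAt` / `HStarReachMix` (p476752) are claim-tagged HYPOTHESIS SHAPES and Σ₂₀′ is the
set of cells where the shape holds — a READING of the datum, never asserted; typed ≠ proved.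

* §S1 `sigmaReachMix X : Set (Fin l⋆ × V_ℚ)` — Σ₂₀′ := every archimedean cell, and the nonarchimedean cells `(i, p)` at which the mixed reach cell
  `CellReachMixAt X p i v⃗` holds on EVERY summand `v⃗` of the packet `(i+1, p)` whose last slot is a bad place (`mem_sigmaReachMix_inr_iff`,
  `mem_sigmaReachMix_inl`); `HStarReachMix X ⟺ sigmaReachMix X = univ` (`sigmaReachMix_eq_univ_iff`).
* §S2 `licenceOn_sigmaReachMix_settingPrVolSharp` — at `Thm311.Real.settingPrVolSharp X …` with ideles HONESTLY realising the pilot divisors, the restricted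
  licence `RH.SigmaLicence.LicenceOn … (sigmaReachMix X)` HOLDS: the any-prime door `qRegion_subset_thetaHull_settingPrVolSharp_of_cellReachMixOn` (p477348)
  cell by cell. So «S|Σ₂₀′» is a theorem of the tree, not a hypothesis.
* §S3 `licenceOn_sigmaReachMix_chosen` — the same at the genuine bed `Cor312Prov.pilotDataOfK D K` with the CHOSEN realising ideles
  `(Cor312Prov.exists_realising_{q,theta}Ideles_pilotDataOfK D).choose` and analytic logarithms: NO residual hypothesis (the F5 [LIC] binder at `σ := Σ₂₀′`).
* §S4 `cellReachMixOn_pilotDataOfK_of_slotReachPacket`, `sigmaSlotReach_subset_sigmaReachMix_pilotDataOfK` — Σ₁₅ ⊆ Σ₂₀′ CELL BY CELL at the genuine bed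
  under EXACTLY the three dictionary binders of the row-15 door of record (inner certificates `hn₀`, outer certificates `hlam`, integer Kummer orders `hmq`):
  the packet-local form of `hStarReachMix_pilotDataOfK_of_slotReachWindowK` (p485345, which is its `Σ₁₅ = univ` case).
[cite: Mochizuki2012, IUTchI Ex. 3.2 (iv) p. 71; IUTchIII Thm. 3.11 (i) (Ind2) p. 154, Cor. 3.12 Step (xi-f) p. 184] [cite: DupuyHilado2025, §3.9, §4.9]
[cite: NeukirchANT1999, Ch. II (5.5)] [claim: Mochizuki2012, status: disputed] for every IUT sentence quoted. 0 sorry; standard axioms.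
-/

noncomputable section

open Set Function Metric NumberField IsDedekindDomain
open scoped Pointwise

namespace Summit.ABC.IUTFork.Repair.RH.LinearReachLaw

open Thm311 Thm311.Real Cor312 Cor312.Setting Cor312Vol Cor312Prov Literature.IUT.LogThetaLattice Literature.IUT.HodgeTheaters
  Literature.IUT.LogVolume Literature.NumberTheory.NumberFields Summit.ABC.IUTFork.Repair.RH.SigmaLicence
  Summit.ABC.IUTFork.Repair.RH.ShellCapacityPlus Summit.ABC.IUTFork.Repair.RHSlotReach Summit.ABC.IUTFork.Repair.RH2SigmaHull
  Literature.NumberTheory.GaloisRepresentations.Ultrametric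

/-! ## §S1. Σ₂₀′ — the window of cells of row 20′ -/

section Sigma

variable {F : Type} [Field F] [NumberField F] (X : PilotData F)

/-- **Σ₂₀′ — the stratum of row 20′ as a WINDOW of cells `(i, v_ℚ) ∈ 𝔽_l^⋇ × V_ℚ`** of a pilot datum `X`: every archimedean cell (both pilot regions are the
whole packet there), and the nonarchimedean cells `(i, p)` such that the mixed reach cell `CellReachMixAt X p i v⃗` (row 20′, p476752: «integer level weights
exist on the summand») holds on EVERY summand `v⃗ = (ev a)_a` of the packet `(i+1, p)` whose LAST slot sits at a bad place. No dictionary: the cell reads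
THE inner conductors / outer orders of `log_p(𝒪^×)` at the true ramification indices. [R-H stratum, hypothesis shape — not a fact]
[cite: Mochizuki2012, IUTchIII Thm. 3.11 (i) (Ind2) p. 154] [claim: Mochizuki2012, status: disputed] -/
@[claim "Mochizuki2012" "disputed"]
def sigmaReachMix : Set (Fin (thetaIndex X).lstar × (thetaIndex X).VQ) :=
  {c | ∀ pp : Nat.Primes, c.2 = .inr pp →
    ∀ ev : (thetaIndex X).Caps (Setting.labelSucc c.1) → (thetaIndex X).Fibre (.inr pp),
      haveI : Fact (pp : ℕ).Prime := ⟨pp.2⟩; placeOf X pp.1 (ev (Fin.last _)) ∈ X.S → CellReachMixAt X pp c.1 ev}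

/-- A nonarchimedean cell `(i, p)` lies in Σ₂₀′ iff the mixed reach cell holds on every bad-last summand of its packet. [folklore] -/
theorem mem_sigmaReachMix_inr_iff (i : Fin (thetaIndex X).lstar) (pp : Nat.Primes) :
    (i, (.inr pp : (thetaIndex X).VQ)) ∈ sigmaReachMix X ↔
      ∀ ev : (thetaIndex X).Caps (Setting.labelSucc i) → (thetaIndex X).Fibre (.inr pp),
        haveI : Fact (pp : ℕ).Prime := ⟨pp.2⟩; placeOf X pp.1 (ev (Fin.last _)) ∈ X.S → CellReachMixAt X pp i ev := by
  constructor
  · intro h; exact h pp rfl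
  · intro h pp' hpp
    cases hpp
    exact h

/-- Every archimedean cell lies in Σ₂₀′. [folklore] -/
theorem mem_sigmaReachMix_inl (i : Fin (thetaIndex X).lstar) (u : Unit) :
    (i, (.inl u : (thetaIndex X).VQ)) ∈ sigmaReachMix X := by
  intro pp hpp
  cases hpp

/-- Σ₂₀′ is EVERYTHING iff row 20′ holds on all summands (`HStarReachMix X`). [folklore] -/
theorem sigmaReachMix_eq_univ_iff : sigmaReachMix X = Set.univ ↔ HStarReachMix X := by
  constructor
  · intro h pp i ev hw
    have hc : (i, (.inr pp : (thetaIndex X).VQ)) ∈ sigmaReachMix X := by rw [h]; trivial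
    exact (mem_sigmaReachMix_inr_iff X i pp).1 hc ev hw
  · intro hH
    exact Set.eq_univ_of_forall fun c pp _ ev hw => hH pp c.1 ev hw

/-- If row 20′ holds on ALL summands, Σ₂₀′ is everything. [folklore] -/
theorem sigmaReachMix_eq_univ_of_hStarReachMix (hH : HStarReachMix X) : sigmaReachMix X = Set.univ :=
  (sigmaReachMix_eq_univ_iff X).2 hH

end Sigma

/-! ## §S2. S|Σ₂₀′ is a THEOREM: the licence holds at every cell of Σ₂₀′ (any pilot datum, ideles honestly realising the pilot divisors) -/

section Setting

variable {F : Type} [Field F] [NumberField F] (X : PilotData F) {logv : PadicLogs F} (hlog : LogvAnalytic logv)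
  (M : Type) [Field M] [NumberField M]
  (archPk : ∀ (j : (thetaIndex X).Label) (vQ : (thetaIndex X).VQ), Set ((logShellsDH X logv).Packet j vQ))
  (archSub : ∀ (j : (thetaIndex X).Label) (v : (thetaIndex X).V),
    Set ((logShellsDH X logv).Packet j ((thetaIndex X).over v)))
  (Ψ : ℤ → ∀ v : (thetaIndex X).V, v ∈ (thetaIndex X).Vbad → Set ((logShellsDH X logv).StarPacket v))
  (act : ℤ → ∀ v : (thetaIndex X).V, v ∈ (thetaIndex X).Vbad →
    (logShellsDH X logv).StarPacket v → Module.End ℚ ((logShellsDH X logv).StarPacket v))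
  (Mmod : ℤ → ∀ j : (thetaIndex X).LabelStar, Set ((logShellsDH X logv).GlobalPacket j.1))
  (region : ℤ → ∀ j : (thetaIndex X).LabelStar, FinDivisor M → ∀ vQ : (thetaIndex X).VQ,
    Set ((logShellsDH X logv).Packet j.1 vQ))
  (n : ℤ) {HT : Type} {LogLink : HT → HT → Type} {IsFull : ∀ {s t : HT}, LogLink s t → Prop}
  (lat : LGPGaussianLogThetaLattice LogLink IsFull)
  {Frd : Type} {IsoF : Frd → Frd → Type} {Ob : Frd → Type} {realify : Frd → Frd} {Strip : Type}
  {IsoS : Strip → Strip → Type} {Mv : ∀ v : (thetaIndex X).V, v ∈ (thetaIndex X).Vbad → Type}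
  [∀ v h, Monoid (Mv v h)]
  (sig : GlobalLGPFrobenioidSignature (thetaIndex X).lstar (thetaIndex X).V (· ∈ (thetaIndex X).Vbad)
    Frd IsoF Ob realify Strip IsoS Mv)
  (split : SplittingMonoids Mv) {ObΔ : Type} {N : ∀ v : (thetaIndex X).V, v ∈ (thetaIndex X).Vbad → Type}
  [∀ v h, Monoid (N v h)] (qData : QPilotData ObΔ N)
  (tq : ∀ (pp : Nat.Primes) (x : (thetaIndex X).Fibre (.inr pp)), haveI : Fact (pp : ℕ).Prime := ⟨pp.2⟩; kOf X pp.1 x)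
  (t : ∀ (pp : Nat.Primes) (_ : Fin X.lstar) (x : (thetaIndex X).Fibre (.inr pp)),
    haveI : Fact (pp : ℕ).Prime := ⟨pp.2⟩; kOf X pp.1 x)
  (htq0 : ∀ pp x, tq pp x ≠ 0)
  (htq1 : ∀ (pp : Nat.Primes) (x : (thetaIndex X).Fibre (.inr pp)),
    haveI : Fact (pp : ℕ).Prime := ⟨pp.2⟩; placeOf X pp.1 x ∉ X.S → ‖tq pp x‖ = 1)
  (ht0 : ∀ pp i x, t pp i x ≠ 0)
  (ht1 : ∀ (pp : Nat.Primes) (i : Fin X.lstar) (x : (thetaIndex X).Fibre (.inr pp)),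
    haveI : Fact (pp : ℕ).Prime := ⟨pp.2⟩; placeOf X pp.1 x ∉ X.S → ‖t pp i x‖ = 1)
  -- the HONEST realising side conditions of the `K`-level certificates (`Cor312Prov.exists_realising_*`)
  (ht : ∀ (pp : Nat.Primes) (i : Fin X.lstar) (x : (thetaIndex X).Fibre (.inr pp)),
    haveI : Fact (pp : ℕ).Prime := ⟨pp.2⟩
    Real.log ‖t pp i x‖ = -(X.thetaPilot i (placeOf X pp.1 x)) * logNorm F (placeOf X pp.1 x) /
      localDegree F (placeOf X pp.1 x))
  (htq : ∀ (pp : Nat.Primes) (x : (thetaIndex X).Fibre (.inr pp)),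
    haveI : Fact (pp : ℕ).Prime := ⟨pp.2⟩
    Real.log ‖tq pp x‖ = -(X.qPilot (placeOf X pp.1 x)) * logNorm F (placeOf X pp.1 x) /
      localDegree F (placeOf X pp.1 x))

include ht0 ht1 ht htq in
/-- **S|Σ₂₀′ IS A THEOREM (any pilot datum, realising ideles).** At `settingPrVolSharp X …` with ideles honestly realising the pilot divisors, the (xi-f) licence
RESTRICTED to Σ₂₀′ — abc-iut-rh2-q2-eq's `RH.SigmaLicence.LicenceOn … (sigmaReachMix X)`: `qRegion (i+1) v_ℚ ⊆ ⁿ˒°𝒰_{i+1,v_ℚ}` at every cell of Σ₂₀′ — HOLDS: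
the any-prime door `qRegion_subset_thetaHull_settingPrVolSharp_of_cellReachMixOn` (p477348; bad-last summands: level movers with weights `p^{k_a+1}·y_a`;
good-last summands: identity movers; archimedean cells: both regions are the packet) cell by cell. Row 20′ is a HYPOTHESIS about the datum; this is the
implication «cell of Σ₂₀′ ⟹ licence at that cell», nothing more. [cite: Mochizuki2012, IUTchIII Cor. 3.12 Step (xi-f) p. 184] [cite: DupuyHilado2025, §3.9, §4.9]
[claim: Mochizuki2012, status: disputed] -/
theorem licenceOn_sigmaReachMix_settingPrVolSharp :
    LicenceOn (settingPrVolSharp X hlog M archPk archSub Ψ act Mmod region n lat sig split qData tq t htq0 htq1) (sigmaReachMix X) := by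
  intro c hc
  refine qRegion_subset_thetaHull_settingPrVolSharp_of_cellReachMixOn X hlog M archPk archSub Ψ act Mmod region n lat sig split qData tq t
    htq0 htq1 ht0 ht1 ht htq (fun pp i => (i, (.inr pp : (thetaIndex X).VQ)) ∈ sigmaReachMix X)
    (fun pp i h => (mem_sigmaReachMix_inr_iff X i pp).1 h) (Setting.labelSucc c.1) c.2 fun pp i hv hj => ?_
  obtain ⟨i₀, vQ⟩ := c
  cases Fin.succ_injective _ hj
  subst hv
  exact hc

include ht0 ht1 ht htq in
/-- Hence Σ₂₀′ lies inside the licence cells `Σ_lic` of the setting (abc-iut-rh2-q2-eq `licenceOn_iff_subset_licenceCells`). [folklore] -/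
theorem sigmaReachMix_subset_licenceCells_settingPrVolSharp :
    sigmaReachMix X ⊆ licenceCells (settingPrVolSharp X hlog M archPk archSub Ψ act Mmod region n lat sig split qData tq t htq0 htq1) :=
  licenceOn_iff_subset_licenceCells.1
    (licenceOn_sigmaReachMix_settingPrVolSharp X hlog M archPk archSub Ψ act Mmod region n lat sig split qData tq t htq0 htq1 ht0 ht1 ht htq)

end Setting

/-! ## §S3. The genuine bed `Cor312Prov.pilotDataOfK D K` with the CHOSEN realising ideles: the F5 [LIC] binder at `σ := Σ₂₀′`, no residual hypothesis -/

section Chosen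

variable {F K Fbar : Type} [Field F] [NumberField F] [Field K] [NumberField K] [Algebra F K] [Field Fbar]
  [Algebra F Fbar] [Algebra K Fbar] {E : WeierstrassCurve F} [E.IsElliptic] {l : ℕ} {Pb : BadPlacePredicates K}
  (D : InitialThetaData F K Fbar E l Pb)
  (M : Type) [Field M] [NumberField M]
  (archPk : ∀ (j : (thetaIndex (pilotDataOfK D K)).Label) (vQ : (thetaIndex (pilotDataOfK D K)).VQ),
    Set ((logShellsDH (pilotDataOfK D K) (analyticLogv K)).Packet j vQ))
  (archSub : ∀ (j : (thetaIndex (pilotDataOfK D K)).Label) (v : (thetaIndex (pilotDataOfK D K)).V),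
    Set ((logShellsDH (pilotDataOfK D K) (analyticLogv K)).Packet j ((thetaIndex (pilotDataOfK D K)).over v)))
  (Ψ : ℤ → ∀ v : (thetaIndex (pilotDataOfK D K)).V, v ∈ (thetaIndex (pilotDataOfK D K)).Vbad →
    Set ((logShellsDH (pilotDataOfK D K) (analyticLogv K)).StarPacket v))
  (act : ℤ → ∀ v : (thetaIndex (pilotDataOfK D K)).V, v ∈ (thetaIndex (pilotDataOfK D K)).Vbad →
    (logShellsDH (pilotDataOfK D K) (analyticLogv K)).StarPacket v →
      Module.End ℚ ((logShellsDH (pilotDataOfK D K) (analyticLogv K)).StarPacket v))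
  (Mmod : ℤ → ∀ j : (thetaIndex (pilotDataOfK D K)).LabelStar, Set ((logShellsDH (pilotDataOfK D K) (analyticLogv K)).GlobalPacket j.1))
  (region : ℤ → ∀ j : (thetaIndex (pilotDataOfK D K)).LabelStar, FinDivisor M → ∀ vQ : (thetaIndex (pilotDataOfK D K)).VQ,
    Set ((logShellsDH (pilotDataOfK D K) (analyticLogv K)).Packet j.1 vQ))
  (n : ℤ) {HT : Type} {LogLink : HT → HT → Type} {IsFull : ∀ {s t : HT}, LogLink s t → Prop}
  (lat : LGPGaussianLogThetaLattice LogLink IsFull)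
  {Frd : Type} {IsoF : Frd → Frd → Type} {Ob : Frd → Type} {realify : Frd → Frd} {Strip : Type}
  {IsoS : Strip → Strip → Type}
  {Mv : ∀ v : (thetaIndex (pilotDataOfK D K)).V, v ∈ (thetaIndex (pilotDataOfK D K)).Vbad → Type} [∀ v h, Monoid (Mv v h)]
  (sig : GlobalLGPFrobenioidSignature (thetaIndex (pilotDataOfK D K)).lstar (thetaIndex (pilotDataOfK D K)).V
    (· ∈ (thetaIndex (pilotDataOfK D K)).Vbad) Frd IsoF Ob realify Strip IsoS Mv)
  (split : SplittingMonoids Mv) {ObΔ : Type}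
  {N : ∀ v : (thetaIndex (pilotDataOfK D K)).V, v ∈ (thetaIndex (pilotDataOfK D K)).Vbad → Type} [∀ v h, Monoid (N v h)]
  (qData : QPilotData ObΔ N)

/-- **Σ₂₀′(T) IS A LICENSED STRATUM (genuine bed, CHOSEN realising ideles, NO residual hypothesis).** At `Cor312Prov.pilotDataOfK D K` ([IUTchI] Ex. 3.2 (iv))
with the chosen realising ideles `(Cor312Prov.exists_realising_{q,theta}Ideles_pilotDataOfK D).choose` and analytic logarithms, the (xi-f) licence holds on
row 20′'s window `Σ₂₀′ := sigmaReachMix (pilotDataOfK D K)` — §S2 fed with the chosen ideles' realising side conditions (`….choose_spec`). So abc-iut-rh2-T-1's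
F5 (a) binder [LIC] at `σ := Σ₂₀′` is a THEOREM (the row-20′ twin of abc-iut-rh2-q2-hull's `licenceOn_sigmaLevelWindow_chosen` / `licenceOn_sigmaSlotReach_chosen`).
[cite: Mochizuki2012, IUTchI Ex. 3.2 (iv) p. 71; IUTchIII Cor. 3.12 Step (xi-f) p. 184] [cite: DupuyHilado2025, §3.9, §4.9] [claim: Mochizuki2012, status: disputed] -/
theorem licenceOn_sigmaReachMix_chosen :
    LicenceOn (settingPrVolSharp (pilotDataOfK D K) (logvAnalytic_analyticLogv (F := K)) M archPk archSub Ψ act Mmod region n lat sig split qData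
        (exists_realising_qIdeles_pilotDataOfK D).choose (exists_realising_thetaIdeles_pilotDataOfK D).choose
        (exists_realising_qIdeles_pilotDataOfK D).choose_spec.1 (exists_realising_qIdeles_pilotDataOfK D).choose_spec.2.1)
      (sigmaReachMix (pilotDataOfK D K)) :=
  licenceOn_sigmaReachMix_settingPrVolSharp (pilotDataOfK D K) (logvAnalytic_analyticLogv (F := K)) M archPk archSub Ψ act Mmod region n
    lat sig split qData (exists_realising_qIdeles_pilotDataOfK D).choose (exists_realising_thetaIdeles_pilotDataOfK D).choose
    (exists_realising_qIdeles_pilotDataOfK D).choose_spec.1 (exists_realising_qIdeles_pilotDataOfK D).choose_spec.2.1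
    (exists_realising_thetaIdeles_pilotDataOfK D).choose_spec.1 (exists_realising_thetaIdeles_pilotDataOfK D).choose_spec.2.1
    (exists_realising_thetaIdeles_pilotDataOfK D).choose_spec.2.2 (exists_realising_qIdeles_pilotDataOfK D).choose_spec.2.2

/-- Hence Σ₂₀′(T) lies inside the licence cells `Σ_lic(T)` of the chosen-ideles setting (the cells abc-iut-rh2-q2-hull's hypothesis-minimal endpoint reads). [folklore] -/
theorem sigmaReachMix_subset_licenceCells_chosen :
    sigmaReachMix (pilotDataOfK D K) ⊆
      licenceCells (settingPrVolSharp (pilotDataOfK D K) (logvAnalytic_analyticLogv (F := K)) M archPk archSub Ψ act Mmod region n lat sig split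
        qData (exists_realising_qIdeles_pilotDataOfK D).choose (exists_realising_thetaIdeles_pilotDataOfK D).choose
        (exists_realising_qIdeles_pilotDataOfK D).choose_spec.1 (exists_realising_qIdeles_pilotDataOfK D).choose_spec.2.1) :=
  licenceOn_iff_subset_licenceCells.1 (licenceOn_sigmaReachMix_chosen D M archPk archSub Ψ act Mmod region n lat sig split qData)

end Chosen

/-! ## §S4. Σ₁₅ ⊆ Σ₂₀′ CELL BY CELL at the genuine bed (the packet-local form of p485345) -/

section Nesting

variable {F K Fbar : Type} [Field F] [NumberField F] [Field K] [NumberField K] [Algebra F K] [Field Fbar]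
  [Algebra F Fbar] [Algebra K Fbar] {E : WeierstrassCurve F} [E.IsElliptic] {l : ℕ} {Pb : BadPlacePredicates K}
  (D : InitialThetaData F K Fbar E l Pb)
  (n₀ : ∀ pp : Nat.Primes, (thetaIndex (pilotDataOfK D K)).Fibre (.inr pp) → ℕ)
  (lam : ∀ pp : Nat.Primes, (thetaIndex (pilotDataOfK D K)).Fibre (.inr pp) → ℝ)
  (mq : ∀ pp : Nat.Primes, (thetaIndex (pilotDataOfK D K)).Fibre (.inr pp) → ℤ)

/-- **ROW 15's PACKET CLAUSE ⟹ ROW 20′'s MIXED CELLS ON THAT PACKET (genuine bed).** Under the dictionary binders of the row-15 door of record (inner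
certificates `hn₀`, outer certificates `hlam`, integer Kummer orders `hmq : m_q(w) = P_q(w)` at the bad places), the slot-reach clause of ONE packet `(i+1, p)`
(`RHSlotReach.SlotReachPacket … p i`, realising profile `m_Θ = j²·m_q`, `e = ramIdx`) gives the mixed reach cell on every bad-last summand of that packet:
apply the clause at `(w := ev last, donors := ev ∘ castSucc)`, compare the certificates with THE lattice integers slot by slot
(`natCast_le_of_isInnerConductor_of_sharp`, `le_neg_div_of_isOuterOrder_of_rad`), pool the levels (`mixedReachCell_of_slotClause`) — the proof of p485345, one
packet at a time. Both rows are HYPOTHESES; this is an implication between them. [cite: Mochizuki2012, IUTchI Ex. 3.2 (iv) p. 71; IUTchIII Thm. 3.11 (i) (Ind2) p. 154]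
[cite: NeukirchANT1999, Ch. II (5.5)] [claim: Mochizuki2012, status: disputed] -/
theorem cellReachMixOn_pilotDataOfK_of_slotReachPacket
    (hn₀ : ∀ (pp : Nat.Primes) (x : (thetaIndex (pilotDataOfK D K)).Fibre (.inr pp)), haveI : Fact (pp : ℕ).Prime := ⟨pp.2⟩
      ∃ u : kOf (pilotDataOfK D K) pp.1 x,
        ‖u‖ ≤ (pp : ℝ) ^ (-(((n₀ pp x : ℤ) - 1 : ℤ) : ℝ) / (ramIdx K (placeOf (pilotDataOfK D K) pp.1 x) : ℝ)) ∧
          u ∉ (logUnits (kOf (pilotDataOfK D K) pp.1 x) : Set (kOf (pilotDataOfK D K) pp.1 x)))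
    (hlam : ∀ (pp : Nat.Primes) (x : (thetaIndex (pilotDataOfK D K)).Fibre (.inr pp)), haveI : Fact (pp : ℕ).Prime := ⟨pp.2⟩
      ∃ z ∈ (logUnits (kOf (pilotDataOfK D K) pp.1 x) : Set (kOf (pilotDataOfK D K) pp.1 x)), (pp : ℝ) ^ (lam pp x) ≤ ‖z‖)
    (hmq : ∀ (pp : Nat.Primes) (w : (thetaIndex (pilotDataOfK D K)).Fibre (.inr pp)), haveI : Fact (pp : ℕ).Prime := ⟨pp.2⟩
      placeOf (pilotDataOfK D K) pp.1 w ∈ (pilotDataOfK D K).S →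
        (mq pp w : ℝ) = (pilotDataOfK D K).qPilot (placeOf (pilotDataOfK D K) pp.1 w))
    (pp : Nat.Primes) (i : Fin (thetaIndex (pilotDataOfK D K)).lstar)
    (h15 : SlotReachPacket (thetaIndex (pilotDataOfK D K)).lstar (fun pp => (thetaIndex (pilotDataOfK D K)).Fibre (.inr pp))
      (fun pp w => haveI : Fact (pp : ℕ).Prime := ⟨pp.2⟩; placeOf (pilotDataOfK D K) pp.1 w ∈ (pilotDataOfK D K).S)
      (fun pp x => haveI : Fact (pp : ℕ).Prime := ⟨pp.2⟩; ramIdx K (placeOf (pilotDataOfK D K) pp.1 x)) n₀ lam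
      (fun pp i w => ((((i : ℕ) : ℤ) + 1) ^ 2) * mq pp w) mq pp i) :
    ∀ ev : (thetaIndex (pilotDataOfK D K)).Caps (Setting.labelSucc i) → (thetaIndex (pilotDataOfK D K)).Fibre (.inr pp),
      haveI : Fact (pp : ℕ).Prime := ⟨pp.2⟩
      placeOf (pilotDataOfK D K) pp.1 (ev (Fin.last _)) ∈ (pilotDataOfK D K).S → CellReachMixAt (pilotDataOfK D K) pp i ev := by
  intro ev hw ϖ hϖ c B hc hB
  haveI : Fact (pp : ℕ).Prime := ⟨pp.2⟩
  -- row 15's clause at `(w := ev last, donors := ev ∘ castSucc)`, ramification dictionary = the true indices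
  have h15' := h15 (ev (Fin.last _)) hw (fun a => ev (Fin.castSucc a))
  simp only [ramIdx_eq] at h15'
  -- per-slot data at the TRUE ramification indices
  have habs : ∀ a, absRamificationIdx pp (kOf (pilotDataOfK D K) pp.1 (ev a)) =
      (placeOf (pilotDataOfK D K) pp.1 (ev a)).asIdeal.ramificationIdx ℤ :=
    fun a => absRamificationIdx_kOf (pilotDataOfK D K) pp (ev a)
  have he1 : ∀ a, 1 ≤ (placeOf (pilotDataOfK D K) pp.1 (ev a)).asIdeal.ramificationIdx ℤ :=
    fun a => Ideal.ramificationIdx_pos _ _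
  -- certificates vs THE integers, slot by slot
  have hnc : ∀ a, n₀ pp (ev a) ≤ c a := fun a => by
    refine natCast_le_of_isInnerConductor_of_sharp (pp : ℕ) (hϖ a) (hc a) ?_
    rw [habs a, ← ramIdx_eq K]
    exact hn₀ pp (ev a)
  have hlB : ∀ a, lam pp (ev a) ≤ -(B a : ℝ) / ((placeOf (pilotDataOfK D K) pp.1 (ev a)).asIdeal.ramificationIdx ℤ : ℝ) :=
    fun a => by
    have h := le_neg_div_of_isOuterOrder_of_rad (pp : ℕ) (hϖ a) (hB a) (hlam pp (ev a))
    rwa [habs a] at h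
  -- `2l·m_q(w) = ord_w(q)` from `m_q(w) = P_q(w) = ord_w(q)/(2l)`
  have hord : (2 * (l : ℤ) * mq pp (ev (Fin.last _)) : ℤ) =
      (pilotDataOfK D K).ordq (placeOf (pilotDataOfK D K) pp.1 (ev (Fin.last _))) := by
    have h := hmq pp (ev (Fin.last _)) hw
    rw [(pilotDataOfK D K).qPilot_apply_of_mem hw, pilotDataOfK_l] at h
    have hl0 : (l : ℝ) ≠ 0 := by exact_mod_cast (pilotDataOfK D K).l_prime.ne_zero
    have h' : (2 * (l : ℝ) * mq pp (ev (Fin.last _)) : ℝ) =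
        (pilotDataOfK D K).ordq (placeOf (pilotDataOfK D K) pp.1 (ev (Fin.last _))) := by
      rw [h]; field_simp
    exact_mod_cast h'
  -- `e_w · μ = m_q(w)` for the goal's depth `μ = ord_w(q)/(2l·e_w)`
  have heQ : ((placeOf (pilotDataOfK D K) pp.1 (ev (Fin.last _))).asIdeal.ramificationIdx ℤ : ℚ) ≠ 0 := by
    have := he1 (Fin.last _)
    exact_mod_cast (by omega : (placeOf (pilotDataOfK D K) pp.1 (ev (Fin.last _))).asIdeal.ramificationIdx ℤ ≠ 0)
  have hl0 : (l : ℚ) ≠ 0 := by exact_mod_cast (pilotDataOfK D K).l_prime.ne_zero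
  have hμ : ((placeOf (pilotDataOfK D K) pp.1 (ev (Fin.last _))).asIdeal.ramificationIdx ℤ : ℚ) *
      (((pilotDataOfK D K).ordq (placeOf (pilotDataOfK D K) pp.1 (ev (Fin.last _))) : ℚ) /
        (2 * (pilotDataOfK D K).l * ((placeOf (pilotDataOfK D K) pp.1 (ev (Fin.last _))).asIdeal.ramificationIdx ℤ : ℚ))) =
      (mq pp (ev (Fin.last _)) : ℚ) := by
    rw [← hord, pilotDataOfK_l]
    push_cast
    field_simp
  -- pool the slot-wise levels
  exact mixedReachCell_of_slotClause (n := (i : ℕ) + 1)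
    (fun a => (placeOf (pilotDataOfK D K) pp.1 (ev a)).asIdeal.ramificationIdx ℤ) (fun a => n₀ pp (ev a)) c B
    (fun a => lam pp (ev a)) (mq pp (ev (Fin.last _))) _ hμ he1 hnc hlB (by push_cast at h15' ⊢; exact h15')

/-- **Σ₁₅ ⊆ Σ₂₀′ AT THE GENUINE BED (cell by cell).** Under the three dictionary binders of the row-15 door of record, row 15's window of cells
`RHSlotReach.sigmaSlotReach (pilotDataOfK D K) ramIdx n₀ λ (j²·m_q) m_q` (abc-iut-rh-typ-12) is contained in row 20′'s `sigmaReachMix (pilotDataOfK D K)`: the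
slot-wise levels of row 15's movers, pooled, are integer level weights on the summand. Hence `B_triv(Σ₂₀′ᶜ) ≤ B_triv(Σ₁₅ᶜ)` for every mass functional
antitone in the stratum (abc-iut-rh2-T-1 `offTrivialMass_anti`): row 20′'s F5 mass binder is the WEAKER one. Both rows are HYPOTHESES.
[cite: Mochizuki2012, IUTchIII Thm. 3.11 (i) (Ind2) p. 154] [claim: Mochizuki2012, status: disputed] -/
theorem sigmaSlotReach_subset_sigmaReachMix_pilotDataOfK
    (hn₀ : ∀ (pp : Nat.Primes) (x : (thetaIndex (pilotDataOfK D K)).Fibre (.inr pp)), haveI : Fact (pp : ℕ).Prime := ⟨pp.2⟩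
      ∃ u : kOf (pilotDataOfK D K) pp.1 x,
        ‖u‖ ≤ (pp : ℝ) ^ (-(((n₀ pp x : ℤ) - 1 : ℤ) : ℝ) / (ramIdx K (placeOf (pilotDataOfK D K) pp.1 x) : ℝ)) ∧
          u ∉ (logUnits (kOf (pilotDataOfK D K) pp.1 x) : Set (kOf (pilotDataOfK D K) pp.1 x)))
    (hlam : ∀ (pp : Nat.Primes) (x : (thetaIndex (pilotDataOfK D K)).Fibre (.inr pp)), haveI : Fact (pp : ℕ).Prime := ⟨pp.2⟩
      ∃ z ∈ (logUnits (kOf (pilotDataOfK D K) pp.1 x) : Set (kOf (pilotDataOfK D K) pp.1 x)), (pp : ℝ) ^ (lam pp x) ≤ ‖z‖)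
    (hmq : ∀ (pp : Nat.Primes) (w : (thetaIndex (pilotDataOfK D K)).Fibre (.inr pp)), haveI : Fact (pp : ℕ).Prime := ⟨pp.2⟩
      placeOf (pilotDataOfK D K) pp.1 w ∈ (pilotDataOfK D K).S →
        (mq pp w : ℝ) = (pilotDataOfK D K).qPilot (placeOf (pilotDataOfK D K) pp.1 w)) :
    sigmaSlotReach (pilotDataOfK D K) (fun pp x => haveI : Fact (pp : ℕ).Prime := ⟨pp.2⟩; ramIdx K (placeOf (pilotDataOfK D K) pp.1 x)) n₀ lam
        (fun pp i w => ((((i : ℕ) : ℤ) + 1) ^ 2) * mq pp w) mq ⊆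
      sigmaReachMix (pilotDataOfK D K) := by
  rintro ⟨i, vQ⟩ hc pp hpp
  exact cellReachMixOn_pilotDataOfK_of_slotReachPacket D n₀ lam mq hn₀ hlam hmq pp i (hc pp hpp)

end Nesting

end Summit.ABC.IUTFork.Repair.RH.LinearReachLaw

end
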